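import Mathlib
import Summits.NavierStokesRegularity.FluidComputer.AbcFlowFrobeniusConstants
import Summits.NavierStokesRegularity.FluidComputer.LinearisedLowerTailForms
import HarnessLib

/-!
# The `H¹` tail form of the ABC linearisation on the unit torus: the level `η₁' = ν(K+1)² + ω − (√3+√2) − √3/(K+1)` in the kernel (cap g5, cell `ns-blowup`, 2026-08-26)

HONEST FRAMING (human ruling D-0035): nothing here is a claim about Navier–Stokes blow-up.
WHAT THIS IS NOT: not NS evidence. The middle tail level (T1) of the D2-3L-X0 certificates in the
booking norm `g_κ₀`, `κ₀ > 0` (`cap/D2-TAIL-KAPPA0.md`; combination `AbcKappa0TailLevels.weighted_levels_le`,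
threshold arithmetic `eta1_generic_at_25_gt` / `eta_t_generic_at_25_eq_eta2`), instantiated for the
TREE object `U = Literature.Analysis.FluidPDE.Torus.abcFlow 1 1 1` in unit-torus scaling, from the
generic `LinearisedLowerTailForms.h1_tail_form_le` and the pointwise ABC facts of
`AbcFlowFrobeniusConstants`:

* `norm_sq_partialDeriv_abcFlow` — per direction, `‖∂ₖU(x)‖² = 4π²aₖ²` (`= 4π²`: `L = 2π`);
* `sum_norm_sq_partialDeriv_partialDeriv_abcFlow_dir` — per direction, `Σⱼ‖∂ⱼ∂ₖU(x)‖² = 16π⁴aₖ²`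
  (Hessian row `L' = 4π²`);
* `abs_inner_fderiv_abcFlow_le` — the strain hypothesis in the `Torus.fderiv` form used by
  `LinearisedLowerTailForms` (`s = 2π√2`);
* `abc_h1_tail_form_le` — for every smooth tail field `w` (`fourierTruncate N w = 0`), `ν ≥ 0`, `ω`:
  `−(ν/4π²)‖Δw‖₂² + (1/2π)∫⟪(U·∇)w + (w·∇)U, Δw⟫ − ω‖∇w‖₂²
     ≤ (−ν(N²+1) − ω + (√3 + √2) + √3/√(N²+1))·‖∇w‖₂²`
  — the `2π`'s cancel; the coefficient is `−η₁'` of `LinearisedLowerTailForms` (module docstring) with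
  `(K+1)² ↔ N²+1`. Together with `AbcFlowL2TailForm.abc_l2_tail_form_le` (η₀) and
  `AbcFlowFrobeniusConstants.abc_tail_form_le` (η₂) all three tail levels of the D2 chain are kernel
  theorems about the tree's ABC field.

Mathlib + `AbcFlowFrobeniusConstants` + `LinearisedLowerTailForms`; no new definitions.
-/

noncomputable section

namespace Summit.NavierStokesRegularity.FluidComputer.AbcFlowH1TailForm

open Literature.Analysis.FluidPDE Literature.Analysis.FunctionSpaces
open Literature.Analysis.FunctionSpaces.Torus MeasureTheory UnitAddTorus
open Summit.NavierStokesRegularity.FluidComputer.AbcFlowFrobeniusConstants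
open Summit.NavierStokesRegularity.FluidComputer.LinearisedLowerTailForms
open scoped RealInnerProductSpace

/-- Addition table of `Fin 3`. -/
private theorem fin3_add :
    (0 : Fin 3) + 1 = 1 ∧ (0 : Fin 3) + 2 = 2 ∧ (1 : Fin 3) + 1 = 2 ∧ (1 : Fin 3) + 2 = 0 ∧
      (2 : Fin 3) + 1 = 0 ∧ (2 : Fin 3) + 2 = 1 := by
  decide

/-- Every index of `Fin 3` is `0`, `1` or `2`. -/
private theorem fin3_cases (i : Fin 3) : i = 0 ∨ i = 1 ∨ i = 2 := by
  fin_cases i <;> simp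

/-- **Per-direction gradient of the ABC flow: `‖∂ₖU(x)‖² = 4π²·aₖ²`** (`a = (B, C, A)`), i.e.
`‖∂ₖU‖ = 2π` pointwise for `abc(1,1,1)` — the `L` of `LinearisedLowerTailForms.h1_tail_form_le`. -/
theorem norm_sq_partialDeriv_abcFlow (A B C : ℝ) (x : UnitAddTorus (Fin 3)) (k : Fin 3) :
    ‖partialDeriv k (Torus.abcFlow A B C) x‖ ^ 2 = 4 * Real.pi ^ 2 * Torus.abcAmp A B C k ^ 2 := by
  have ek := re_sq_add_im_sq_mFourier (Pi.single k (1:ℤ)) x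
  obtain ⟨h01, h02, h11, h12, h21, h22⟩ := fin3_add
  rw [EuclideanSpace.real_norm_sq_eq, Fin.sum_univ_three]
  rcases fin3_cases k with rfl | rfl | rfl <;>
    simp [partialDeriv_abcFlow_apply, h01, h02, h11, h12, h21, h22, Torus.abcAmp] <;>
    first
      | linear_combination (4 * Real.pi ^ 2 * B ^ 2) * ek
      | linear_combination (4 * Real.pi ^ 2 * C ^ 2) * ek
      | linear_combination (4 * Real.pi ^ 2 * A ^ 2) * ek

/-- **Per-direction Hessian row of the ABC flow: `Σⱼ‖∂ⱼ∂ₖU(x)‖² = 16π⁴·aₖ²`**, i.e. the Hessian-row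
bound `L' = 4π²` for `abc(1,1,1)`. -/
theorem sum_norm_sq_partialDeriv_partialDeriv_abcFlow_dir (A B C : ℝ) (x : UnitAddTorus (Fin 3))
    (k : Fin 3) :
    ∑ j, ‖partialDeriv j (partialDeriv k (Torus.abcFlow A B C)) x‖ ^ 2
      = 16 * Real.pi ^ 4 * Torus.abcAmp A B C k ^ 2 := by
  have ek := re_sq_add_im_sq_mFourier (Pi.single k (1:ℤ)) x
  obtain ⟨h01, h02, h11, h12, h21, h22⟩ := fin3_add
  simp only [EuclideanSpace.real_norm_sq_eq, Fin.sum_univ_three]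
  rcases fin3_cases k with rfl | rfl | rfl <;>
    simp [partialDeriv_partialDeriv_abcFlow_apply, h01, h02, h11, h12, h21, h22, Torus.abcAmp] <;>
    first
      | linear_combination (16 * Real.pi ^ 4 * B ^ 2) * ek
      | linear_combination (16 * Real.pi ^ 4 * C ^ 2) * ek
      | linear_combination (16 * Real.pi ^ 4 * A ^ 2) * ek

/-- The strain bound in the `Torus.fderiv` form used by `LinearisedLowerTailForms`:
`|⟪a, DU(x)a⟫| ≤ 2π√2‖a‖²` for `U = abc(1,1,1)`. -/
theorem abs_inner_fderiv_abcFlow_le (x : UnitAddTorus (Fin 3)) (a : EuclideanSpace ℝ (Fin 3)) :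
    |⟪a, Torus.fderiv (Torus.abcFlow 1 1 1) x a⟫| ≤ 2 * Real.pi * Real.sqrt 2 * ‖a‖ ^ 2 := by
  rw [fderiv_apply_eq_sum_partialDeriv ((Torus.isSmooth_abcFlow 1 1 1).isContDiff (by simp)) x a,
    real_inner_comm]
  exact abs_inner_strain_abcFlow_le x a

/-- **The `H¹` tail form of the ABC linearisation (kernel form of the level `η₁'`).** For
`U = abc(1,1,1)` on the unit torus, every smooth tail field `w` with `fourierTruncate N w = 0`,
`ν ≥ 0` and `ω ∈ ℝ`:
`−(ν/4π²)∫‖Δw‖² + (1/2π)∫⟪(U·∇)w + (w·∇)U, Δw⟫ − ω‖∇w‖₂²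
   ≤ (−ν(N²+1) − ω + (√3 + √2) + √3/√(N²+1))·‖∇w‖₂²` (`‖∇w‖₂² = gradNormSq w`). -/
theorem abc_h1_tail_form_le {w : UnitAddTorus (Fin 3) → EuclideanSpace ℝ (Fin 3)} (hw : IsSmooth w)
    {N : ℕ} (h0 : fourierTruncate N w = fun _ => 0) {ν ω : ℝ} (hν : 0 ≤ ν) :
    -(ν / (4 * Real.pi ^ 2) * ∫ y, ‖laplacian w y‖ ^ 2)
      + 1 / (2 * Real.pi) * (∫ y, ⟪convect (Torus.abcFlow 1 1 1) w y + convect w (Torus.abcFlow 1 1 1) y,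
          laplacian w y⟫)
      - ω * gradNormSq w
      ≤ (-(ν * ((N : ℝ) ^ 2 + 1)) - ω + (Real.sqrt 3 + Real.sqrt 2)
          + Real.sqrt 3 / Real.sqrt ((N : ℝ) ^ 2 + 1)) * gradNormSq w := by
  set U := Torus.abcFlow (1:ℝ) 1 1 with hU
  have hπ : 0 < Real.pi := Real.pi_pos
  have h2π : 0 < 2 * Real.pi := by positivity
  -- host constants L = 2π, L' = 4π², s = 2π√2
  have hL : ∀ (k : Fin 3) (x : UnitAddTorus (Fin 3)), ‖partialDeriv k U x‖ ≤ 2 * Real.pi := by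
    intro k x
    have h := norm_sq_partialDeriv_abcFlow 1 1 1 x k
    have ha : Torus.abcAmp (1:ℝ) 1 1 k ^ 2 = 1 := by
      rcases fin3_cases k with rfl | rfl | rfl <;> simp [Torus.abcAmp]
    rw [ha, mul_one] at h
    have h' : ‖partialDeriv k U x‖ ^ 2 = (2 * Real.pi) ^ 2 := by rw [hU, h]; ring
    refine le_of_eq ?_
    calc ‖partialDeriv k U x‖ = Real.sqrt (‖partialDeriv k U x‖ ^ 2) := (Real.sqrt_sq (norm_nonneg _)).symm
      _ = Real.sqrt ((2 * Real.pi) ^ 2) := by rw [h']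
      _ = 2 * Real.pi := Real.sqrt_sq h2π.le
  have hL' : ∀ (k : Fin 3) (x : UnitAddTorus (Fin 3)),
      Real.sqrt (∑ j, ‖partialDeriv j (partialDeriv k U) x‖ ^ 2) ≤ 4 * Real.pi ^ 2 := by
    intro k x
    have h := sum_norm_sq_partialDeriv_partialDeriv_abcFlow_dir 1 1 1 x k
    have ha : Torus.abcAmp (1:ℝ) 1 1 k ^ 2 = 1 := by
      rcases fin3_cases k with rfl | rfl | rfl <;> simp [Torus.abcAmp]
    rw [ha, mul_one] at h
    rw [hU, h, show (16 * Real.pi ^ 4 : ℝ) = (4 * Real.pi ^ 2) ^ 2 by ring,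
      Real.sqrt_sq (by positivity)]
  have hS : ∀ (x : UnitAddTorus (Fin 3)) (a : EuclideanSpace ℝ (Fin 3)),
      |⟪a, Torus.fderiv U x a⟫| ≤ 2 * Real.pi * Real.sqrt 2 * ‖a‖ ^ 2 :=
    fun x a => abs_inner_fderiv_abcFlow_le x a
  have hmain := LinearisedLowerTailForms.h1_tail_form_le (Torus.isSmooth_abcFlow 1 1 1)
    (Torus.isDivFree_abcFlow 1 1 1) hw h0 (ν := ν / (2 * Real.pi)) (ω := 2 * Real.pi * ω)
    (div_nonneg hν h2π.le) h2π.le (by positivity) hS hL hL'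
  -- rescale by 1/(2π)
  set G : ℝ := gradNormSq w with hG
  set I1 : ℝ := ∫ y, ‖laplacian w y‖ ^ 2 with hI1
  set I2 : ℝ := ∫ y, ⟪convect U w y + convect w U y, laplacian w y⟫ with hI2
  have hcard : Real.sqrt (Fintype.card (Fin 3)) = Real.sqrt 3 := by simp
  have hΛ : Real.sqrt (4 * Real.pi ^ 2 * ((N : ℝ) ^ 2 + 1)) = 2 * Real.pi * Real.sqrt ((N : ℝ) ^ 2 + 1) := by
    rw [Real.sqrt_mul (by positivity), show (4 * Real.pi ^ 2 : ℝ) = (2 * Real.pi) ^ 2 by ring,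
      Real.sqrt_sq h2π.le]
  rw [hcard, hΛ] at hmain
  have hsq : 0 < Real.sqrt ((N : ℝ) ^ 2 + 1) := Real.sqrt_pos.mpr (by positivity)
  have key : -(ν / (4 * Real.pi ^ 2) * I1) + 1 / (2 * Real.pi) * I2 - ω * G
      = (1 / (2 * Real.pi)) * (-(ν / (2 * Real.pi) * I1) + I2 - 2 * Real.pi * ω * G) := by
    field_simp
    ring
  have key2 : (1 / (2 * Real.pi)) * ((-(ν / (2 * Real.pi) * (4 * Real.pi ^ 2 * ((N : ℝ) ^ 2 + 1)))
        - 2 * Real.pi * ω + Real.sqrt 3 * (2 * Real.pi) + 2 * Real.pi * Real.sqrt 2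
        + Real.sqrt 3 * (4 * Real.pi ^ 2) / (2 * Real.pi * Real.sqrt ((N : ℝ) ^ 2 + 1))) * G)
      = (-(ν * ((N : ℝ) ^ 2 + 1)) - ω + (Real.sqrt 3 + Real.sqrt 2)
          + Real.sqrt 3 / Real.sqrt ((N : ℝ) ^ 2 + 1)) * G := by
    field_simp
    ring
  rw [key, ← key2]
  exact mul_le_mul_of_nonneg_left hmain (by positivity)

end Summit.NavierStokesRegularity.FluidComputer.AbcFlowH1TailForm
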